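import Literature.Computability.AlgebraicComplexity.MatMulRankLowerBoundsBlaserProofs
import Literature.Computability.AlgebraicComplexity.BorderRankMatMulLandsbergOttavianiAllFields
import HarnessLib

/-!
# Landsberg 2014, Thm. 1.2 — `R(⟨n,n,n⟩) ≥ (3 − 1/(p+1))n² − (1 + 2p·C(2p,p−1))n` — over EVERY field

Topic `Literature/Computability/AlgebraicComplexity`. Source: J. M. Landsberg, *New lower bounds for the
rank of matrix multiplication*, SIAM J. Comput. 43 (2014) 144–149, Thm. 1.2 ("I work over the complex
numbers throughout"); the tree vendors it as the named fact `Landsberg2014_thm_1_2` (over `ℂ`,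
`MatMulRankLowerBounds.lean`) with the discharge `Landsberg2014_thm_1_2_holds`
(`MatMulRankLowerBoundsProofs.lean`), and proves the mechanism over every INFINITE field
(`Landsberg2014_prop_2_1_koszul_field`, `MatMulRankLowerBoundsBlaserProofs.lean`: "the same proof, which
uses the ground field only through Lemma 2.2, valid over any infinite integral domain").

## What is proved (theorems only; no definitions, no named facts)

* `Landsberg2014_thm_1_2_of_infinite` — the printed bound for every infinite field `K`: the proof of
  `Landsberg2014_thm_1_2_holds` verbatim with (i) `Landsberg2014_prop_2_1_koszul_field` for the `ℂ`
  version, (ii) for `p = 1` the commutator projection with `n` distinct diagonal entries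
  (`exists_matMulKoszulMatrix_one_injective`) instead of `diag(0,…,n−1)`, (iii) for `p ≥ 2` the LO15
  projection in Lagrange form at `2p+1` distinct nodes (`matMulKoszulMatrix_injective_of_nodes`,
  `BorderRankMatMulLandsbergOttavianiAllFields.lean`) instead of the nodes `0,…,2p`.
* **`Landsberg2014_thm_1_2_allFields`** — the bound over EVERY field `K`: the rank only drops under
  extension of scalars (`tensorRank_matMulTensor_map_le`) and the algebraic closure is infinite — the
  descent already used for Bläser's `(5/2)n² − 3n` (`Blaser1999_rank_lower_bound_holds`).

RENDERING NOTE (generality): Landsberg states Thm. 1.2 over `ℂ`; nothing in the printed proof beyond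
Lemma 2.2 (infinite field) and Prop. 2.1 uses `ℂ`, as the tree's every-infinite-field mechanism records.
Consequence: the every-field rank floor of `⟨n,n,n⟩` rises from `(5/2)n² − 3n` (Bläser 1999, = the case
`p = 1`) to `3n² − o(n²)`.

HONEST FRAMING: a known bound, kernel-checked in every characteristic; nothing here bears on the exponent.

## References

* [Landsberg2014] J. M. Landsberg, *New lower bounds for the rank of matrix multiplication*, SIAM J.
  Comput. 43 (2014) 144–149, Thm. 1.2, Prop. 2.1, Lemma 2.2, §§3–4.
* [LandsbergOttaviani2015] J. M. Landsberg, G. Ottaviani, Theory Comput. 11 (2015), §3 (injectivity).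
* [Blaser1999] M. Bläser, FOCS 1999, Thm. 2 (the case `p = 1` over arbitrary fields).
-/

noncomputable section

open scoped BigOperators
open Matrix Module

namespace Literature.Computability.AlgebraicComplexity

universe u

/-- **Landsberg 2014, Thm. 1.2, over every infinite field `K`:** for `1 ≤ p ≤ n − 1`,
`R(⟨n,n,n⟩_K) ≥ (3 − 1/(p+1)) n² − (1 + 2p·C(2p, p−1)) n`. [cite: Landsberg2014, Thm 1.2 and §§3–4] -/
theorem Landsberg2014_thm_1_2_of_infinite (K : Type u) [Field K] [Infinite K] (n p : ℕ) (hp : 1 ≤ p)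
    (hpn : p ≤ n - 1) :
    (3 - 1 / ((p : ℝ) + 1)) * (n : ℝ) ^ 2 - (1 + 2 * (p : ℝ) * (Nat.choose (2 * p) (p - 1) : ℝ)) * n ≤
      (tensorRank (matMulTensor K n n n) : ℝ) := by
  classical
  have hsq : ((n : ℝ)) ^ 2 ≤ (tensorRank (matMulTensor K n n n) : ℝ) := by
    exact_mod_cast matMulTensor_sq_le_tensorRank K n
  have hn2 : 2 ≤ n := by omega
  have hn0 : (0 : ℝ) ≤ n := Nat.cast_nonneg n
  rcases eq_or_lt_of_le hp with rfl | hp2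
  · -- `p = 1`: the commutator projection, `ρ = 3n`
    let d : Fin n → K := fun i => Infinite.natEmbedding K i
    have hd : Function.Injective d := fun i j h => Fin.ext (by simpa [d] using h)
    obtain ⟨Φ₁, hΦ₁⟩ := exists_matMulKoszulMatrix_one_injective K n hn2 d hd
    obtain ⟨ε, hε⟩ := exists_det_submatrix_ne_zero_of_injective (matMulKoszulMatrix n 1 Φ₁)
      (by simp [Fintype.card_prod]) hΦ₁
    have key := Landsberg2014_prop_2_1_koszul_field n n 1 (by omega) Φ₁
      (ι := PSub (2 * 1 + 1) (1 + 1) × Fin n) id ε (by simpa using hε)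
    have hcard : Fintype.card (PSub (2 * 1 + 1) (1 + 1) × Fin n) = 3 * n := by
      simp [Fintype.card_prod]
    have hc : (2 * 1).choose 1 = 2 := by decide
    rw [hcard, hc] at key
    have key' : (n : ℝ) * (3 * n) + 2 * (n : ℝ) ^ 2 ≤
        2 * (3 * n + (tensorRank (matMulTensor K n n n) : ℝ)) := by
      exact_mod_cast key
    norm_num
    nlinarith [key']
  · -- `p ≥ 2`: blocks
    set r := tensorRank (matMulTensor K n n n) with hr
    set C := (2 * p).choose p with hC
    have hC2p : 2 * p ≤ C := by
      have := Nat.choose_le_middle 1 (2 * p)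
      rwa [Nat.choose_one_right, show 2 * p / 2 = p by omega] at this
    have hCpos : 0 < C := by omega
    have hC' : (p + 1) * (2 * p).choose (p - 1) = p * C := by
      have := Nat.choose_succ_right_eq (2 * p) (p - 1)
      rw [show p - 1 + 1 = p by omega, show 2 * p - (p - 1) = p + 1 by omega] at this
      rw [mul_comm, ← this, mul_comm]
    have hD : (2 * p + 1).choose (p + 1) * (p + 1) = (2 * p + 1) * C := by
      exact (Nat.add_one_mul_choose_eq (2 * p) p).symm
    have hp1 : (0 : ℝ) < (p : ℝ) + 1 := by positivity
    have hp2r : (2 : ℝ) ≤ p := by exact_mod_cast hp2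
    have hC2pr : 2 * (p : ℝ) ≤ C := by exact_mod_cast hC2p
    have hC'r : ((p : ℝ) + 1) * ((2 * p).choose (p - 1) : ℝ) = p * C := by exact_mod_cast hC'
    have h3eq : ((p : ℝ) + 1) * ((3 - 1 / ((p : ℝ) + 1)) * (n : ℝ) ^ 2 -
        (1 + 2 * (p : ℝ) * ((2 * p).choose (p - 1) : ℝ)) * n) =
        (3 * p + 2) * (n : ℝ) ^ 2 - (p + 1) * n
          - 2 * p * (((p : ℝ) + 1) * ((2 * p).choose (p - 1) : ℝ)) * n := by
      field_simp
      ring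
    rw [hC'r] at h3eq
    refine le_of_mul_le_mul_left ?_ hp1
    rw [h3eq]
    by_cases hnC : n ≤ C
    · -- small `n`: the printed bound is at most `n² ≤ R`
      have h1 : (2 * p + 1) * n ≤ 2 * p ^ 2 * C :=
        calc (2 * p + 1) * n ≤ (2 * p + 1) * C := Nat.mul_le_mul_left _ hnC
          _ ≤ 2 * p ^ 2 * C := Nat.mul_le_mul_right _ (by nlinarith)
      have h1' : ((2 : ℝ) * p + 1) * n ≤ 2 * (p : ℝ) ^ 2 * C := by exact_mod_cast h1
      have h1'' := mul_le_mul_of_nonneg_right h1' hn0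
      have hsq' := mul_le_mul_of_nonneg_left hsq (Nat.cast_nonneg p)
      linarith [h1'', hsq, hsq', mul_nonneg (Nat.cast_nonneg p) hn0]
    · -- large `n`: block construction
      push Not at hnC
      set q := n / (p + 1) with hq
      set rem := n % (p + 1) with hrem'
      have hnq : n = (p + 1) * q + rem := (Nat.div_add_mod n (p + 1)).symm
      have hrem : rem ≤ p := Nat.lt_succ_iff.1 (Nat.mod_lt n (Nat.succ_pos p))
      -- the LO15 projection in Lagrange form at `2p+1` distinct nodes of the infinite field `K`
      let c : Fin (2 * p + 1) → K := fun j => Infinite.natEmbedding K j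
      have hc : Function.Injective c := fun i j h => Fin.ext (by simpa [c] using h)
      let Φ₀ : (Fin (p + 1) × Fin (p + 1) → K) →ₗ[K] (Fin (2 * p + 1) → K) :=
        (Matrix.of fun (i : Fin (2 * p + 1)) (a : Fin (p + 1) × Fin (p + 1)) =>
          c i ^ ((a.1 : ℕ) + a.2)).mulVecLin
      have hΦ₀ : ∀ (κ ν : Fin (p + 1)) (j : Fin (2 * p + 1)),
          Φ₀ (Pi.single (κ, ν) 1) j = c j ^ ((κ : ℕ) + ν) := by
        intro κ ν j
        simp [Φ₀, Matrix.mulVec, dotProduct, Pi.single_apply]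
      obtain ⟨ε, hε⟩ := exists_det_submatrix_ne_zero_of_injective
        (matMulKoszulMatrix (p + 1) p Φ₀)
        (by simp [Fintype.card_prod, Nat.choose_symm_half])
        (matMulKoszulMatrix_injective_of_nodes p c hc Φ₀ hΦ₀)
      have hdet := det_blocks_ne_zero n p Φ₀ ε hε
      have key := Landsberg2014_prop_2_1_koszul_field n n p (by omega) (blockProj n p Φ₀) _ _ hdet
      have hcard : Fintype.card ((PSub (2 * p + 1) (p + 1) × Fin (p + 1)) × Fin (n / (p + 1))) =
          (2 * p + 1) * C * q := by
        rw [Fintype.card_prod, Fintype.card_prod, card_PSub, Fintype.card_fin, Fintype.card_fin,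
          hD]
      rw [hcard] at key
      have keyr : (n : ℝ) * ((2 * p + 1) * C * q) + C * (n : ℝ) ^ 2 ≤
          C * ((2 * p + 1) * C * q + r) := by exact_mod_cast key
      have hCr : (0 : ℝ) < C := by exact_mod_cast hCpos
      have h1 : (n : ℝ) ^ 2 + (2 * p + 1) * (n - C) * q ≤ r := by
        refine le_of_mul_le_mul_left ?_ hCr
        linarith [keyr]
      have hq' : ((p : ℝ) + 1) * q = n - rem := by
        have : (n : ℝ) = ((p : ℝ) + 1) * q + rem := by exact_mod_cast hnq
        linarith
      have hremr : (rem : ℝ) ≤ p := by exact_mod_cast hrem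
      have hnCr : (C : ℝ) < n := by exact_mod_cast hnC
      have h2' : (2 * p + 1) * ((n : ℝ) - C) * (n - p) ≤ (p + 1) * ((2 * p + 1) * (n - C) * q) := by
        have hnn : (0 : ℝ) ≤ (2 * p + 1) * (n - C) :=
          mul_nonneg (by positivity) (sub_nonneg.2 hnCr.le)
        calc (2 * p + 1) * ((n : ℝ) - C) * (n - p) ≤ (2 * p + 1) * (n - C) * (n - rem) :=
              mul_le_mul_of_nonneg_left (by linarith) hnn
          _ = (p + 1) * ((2 * p + 1) * (n - C) * q) := by rw [← hq']; ring
      have hcoef : (0 : ℝ) ≤ 1 - 2 * (p : ℝ) ^ 2 + (2 * (p : ℝ) ^ 2 - 2 * p - 1) * C := by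
        have ht : (0 : ℝ) ≤ (p : ℝ) - 2 := sub_nonneg.2 hp2r
        have hB : (0 : ℝ) ≤ 2 * (p : ℝ) ^ 2 - 2 * p - 1 := by linarith [mul_nonneg ht ht]
        have := mul_le_mul_of_nonneg_left hC2pr hB
        linarith [mul_nonneg (mul_nonneg ht ht) ht, mul_nonneg ht ht]
      have h3 : (3 * p + 2) * (n : ℝ) ^ 2 - (p + 1) * n - 2 * p * (p * C) * n ≤
          (p + 1) * (n : ℝ) ^ 2 + (2 * p + 1) * (n - C) * (n - p) := by
        linarith [mul_nonneg hcoef hn0, mul_nonneg (Nat.cast_nonneg p) hCr.le,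
          mul_nonneg (mul_nonneg (Nat.cast_nonneg p) (Nat.cast_nonneg p)) hCr.le]
      have h1p := mul_le_mul_of_nonneg_left h1 hp1.le
      linarith [h1p, h2', h3]

/-- **Landsberg 2014, Thm. 1.2, over EVERY field `K`:** for `1 ≤ p ≤ n − 1`,
`R(⟨n,n,n⟩_K) ≥ (3 − 1/(p+1)) n² − (1 + 2p·C(2p, p−1)) n` — base change to the (infinite) algebraic
closure, under which the rank can only drop (`tensorRank_matMulTensor_map_le`).
[cite: Landsberg2014, Thm 1.2] -/
theorem Landsberg2014_thm_1_2_allFields (K : Type u) [Field K] (n p : ℕ) (hp : 1 ≤ p)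
    (hpn : p ≤ n - 1) :
    (3 - 1 / ((p : ℝ) + 1)) * (n : ℝ) ^ 2 - (1 + 2 * (p : ℝ) * (Nat.choose (2 * p) (p - 1) : ℝ)) * n ≤
      (tensorRank (matMulTensor K n n n) : ℝ) :=
  calc (3 - 1 / ((p : ℝ) + 1)) * (n : ℝ) ^ 2 - (1 + 2 * (p : ℝ) * (Nat.choose (2 * p) (p - 1) : ℝ)) * n
      ≤ (tensorRank (matMulTensor (AlgebraicClosure K) n n n) : ℝ) :=
        Landsberg2014_thm_1_2_of_infinite (AlgebraicClosure K) n p hp hpn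
    _ ≤ (tensorRank (matMulTensor K n n n) : ℝ) := by
        exact_mod_cast tensorRank_matMulTensor_map_le (algebraMap K (AlgebraicClosure K)) n n n

/-- The case `p = 2` in closed form over every field: `R(⟨n,n,n⟩) ≥ (8/3)n² − 17n` for `n ≥ 3`
(`C(4,1) = 4`). [cite: Landsberg2014, Thm 1.2] -/
theorem Landsberg2014_thm_1_2_allFields_two (K : Type u) [Field K] (n : ℕ) (hn : 3 ≤ n) :
    (8 / 3 : ℝ) * (n : ℝ) ^ 2 - 17 * n ≤ (tensorRank (matMulTensor K n n n) : ℝ) := by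
  have h := Landsberg2014_thm_1_2_allFields K n 2 (by norm_num) (by omega)
  have hc : (Nat.choose (2 * 2) (2 - 1) : ℝ) = 4 := by norm_num [Nat.choose]
  rw [hc] at h
  push_cast at h
  linarith [h]

end Literature.Computability.AlgebraicComplexity

end
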